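import Summits.CriticalPhenomena.CardyFormulaZ2.Theorems.CardySusyWardDiscretisationFamilyExistsOneSided
import Summits.CriticalPhenomena.CardyFormulaZ2.Theorems.CardySusyWardDiscretisationFamilyExistsFarPole
import Summits.CriticalPhenomena.CardyFormulaZ2.Theorems.CardySusyWardDiscretisationFamilyExistsLegCommon
import Mathlib.Analysis.InnerProductSpace.Basic
import HarnessLib

/-!
# The two sides of the cross-cut: sector, no forced site, distance to the arcs — helper for `DiscretisationFamilyExists` (stmt-CriticalPhenomena-9644)

Fixed mesh, bare data `⟨Ω, δ, ∅, ∅⟩`, two disjoint open sets `U₁, U₂` with `Ω ⊆ U₁ ∪ U₂ ∪ χ`,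
`frontier U₁ ∩ frontier U₂ ⊆ χ` (the two sides of a cross-cut `χ`).
* `sector_split`: at a point `z₀ ∈ χ` on the frontier of both sides where `χ` is locally
  contained in a line, the two open half-discs lie on different sides.
* `not_closedBall_subset_side`: NO FORCED SITE — a boundary site on one side is not covered by
  the discs of the boundary sites on the other side, provided adjacent sites on different sides
  only occur along the two cut edges, whose far-pole boxes are free of `χ` and which are
  non-degenerate (`…ExistsCover`, `…ExistsFarPole`).
* `infDist_arc_le_side`: a boundary site on one side is close to the corresponding arc.
* `sym2_eq_of_midpoint_mem_segment`: a closed lattice edge through the midpoint of a lattice edge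
  is that edge.
-/

noncomputable section

open Set Metric
open Literature.Probability.LatticeModels Literature.Probability.Percolation
  Literature.Probability.LatticeModels.DiscreteDobrushin

namespace Summit.CriticalPhenomena.CardyFormulaZ2.Theorems.DiscretisationFamilyExists

/-! ### The sector -/

/-- **The two half-discs at a sector point lie on different sides.** [folklore] -/
theorem sector_split {Ω χ U₁ U₂ : Set ℂ} (h₁ : IsOpen U₁) (h₂ : IsOpen U₂) (hdisj : Disjoint U₁ U₂)
    (hχ : IsClosed χ) (hD : Ω ⊆ U₁ ∪ U₂ ∪ χ) (hfr : frontier U₁ ∩ frontier U₂ ⊆ χ)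
    {z₀ w : ℂ} {ε : ℝ} (hz₁ : z₀ ∈ frontier U₁) (hz₂ : z₀ ∈ frontier U₂) (hw : w ≠ 0)
    (hball : ball z₀ ε ⊆ Ω) (hline : χ ∩ ball z₀ ε ⊆ {z | inner (ℝ) (z - z₀) w = 0})
    {p q : ℂ} (hp : p ∈ ball z₀ ε) (hpw : 0 < inner (ℝ) (p - z₀) w)
    (hq : q ∈ ball z₀ ε) (hqw : inner (ℝ) (q - z₀) w < 0) :
    (p ∈ U₁ ∧ q ∈ U₂) ∨ (p ∈ U₂ ∧ q ∈ U₁) := by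
  have hε : 0 < ε := by
    have := mem_ball.1 hp; linarith [dist_nonneg (x := p) (y := z₀)]
  -- the two open half-discs
  set Hp : Set ℂ := ball z₀ ε ∩ {z | inner (ℝ) z₀ w < inner (ℝ) z w} with hHp
  set Hq : Set ℂ := ball z₀ ε ∩ {z | inner (ℝ) z w < inner (ℝ) z₀ w} with hHq
  have hlin : ∀ z : ℂ, inner (ℝ) (z - z₀) w = inner (ℝ) z w - inner (ℝ) z₀ w := fun z => inner_sub_left _ _ _
  have hlinmap : IsLinearMap ℝ fun z : ℂ => inner (ℝ) z w :=
    ⟨fun x y => inner_add_left x y w, fun c x => by rw [real_inner_smul_left, smul_eq_mul]⟩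
  have hHpc : IsPreconnected Hp := ((convex_ball z₀ ε).inter (convex_halfSpace_gt hlinmap _)).isPreconnected
  have hHqc : IsPreconnected Hq := ((convex_ball z₀ ε).inter (convex_halfSpace_lt hlinmap _)).isPreconnected
  have hHpΩ : Hp ⊆ Ω := fun z hz => hball hz.1
  have hHqΩ : Hq ⊆ Ω := fun z hz => hball hz.1
  have hHpχ : Disjoint Hp χ := Set.disjoint_left.2 fun z hz hzχ => by
    have := hline ⟨hzχ, hz.1⟩; rw [mem_setOf_eq, hlin] at this
    have := hz.2; rw [mem_setOf_eq] at this; linarith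
  have hHqχ : Disjoint Hq χ := Set.disjoint_left.2 fun z hz hzχ => by
    have := hline ⟨hzχ, hz.1⟩; rw [mem_setOf_eq, hlin] at this
    have := hz.2; rw [mem_setOf_eq] at this; linarith
  have hpH : p ∈ Hp := ⟨hp, by rw [mem_setOf_eq]; rw [hlin] at hpw; linarith⟩
  have hqH : q ∈ Hq := ⟨hq, by rw [mem_setOf_eq]; rw [hlin] at hqw; linarith⟩
  have hsideP := subset_or_subset_of_isPreconnected h₁ h₂ hdisj hχ hD hfr hHpc hHpΩ hHpχ
  have hsideQ := subset_or_subset_of_isPreconnected h₁ h₂ hdisj hχ hD hfr hHqc hHqΩ hHqχ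
  -- both half-discs on one side `V` is impossible when `z₀` is on the frontier of the other side `W`
  have key : ∀ V W : Set ℂ, IsOpen W → Disjoint V W → z₀ ∈ frontier W → Hp ⊆ V → Hq ⊆ V → False := by
    intro V W hWo hVW hzW hPV hQV
    have hzcl : z₀ ∈ closure W := frontier_subset_closure hzW
    obtain ⟨y, hyb, hyW⟩ : (ball z₀ ε ∩ W).Nonempty := mem_closure_iff_nhds.1 hzcl _ (ball_mem_nhds z₀ hε)
    rcases lt_or_ge (inner (ℝ) y w) (inner (ℝ) z₀ w) with hlt | hge
    · exact Set.disjoint_left.1 hVW (hQV ⟨hyb, hlt⟩) hyW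
    · -- push `y` a little in the direction `w`
      obtain ⟨ρ, hρ, hρsub⟩ := Metric.isOpen_iff.1 (isOpen_ball.inter hWo) y ⟨hyb, hyW⟩
      set t : ℝ := ρ / (2 * ‖w‖) with ht
      have hwpos : 0 < ‖w‖ := norm_pos_iff.2 hw
      have htpos : 0 < t := by positivity
      have hy' : y + (t : ℂ) * w ∈ ball y ρ := by
        rw [mem_ball, dist_eq_norm, add_sub_cancel_left, norm_mul, Complex.norm_real, Real.norm_eq_abs,
          abs_of_pos htpos, ht]
        have : ρ / (2 * ‖w‖) * ‖w‖ = ρ / 2 := by field_simp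
        rw [this]; linarith
      obtain ⟨hy'b, hy'W⟩ := hρsub hy'
      have hinner : inner (ℝ) (y + (t : ℂ) * w) w = inner (ℝ) y w + t * ‖w‖ ^ 2 := by
        rw [inner_add_left, show ((t : ℂ) * w) = (t : ℝ) • w by rw [Complex.real_smul], real_inner_smul_left,
          real_inner_self_eq_norm_sq]
      have hy'P : y + (t : ℂ) * w ∈ Hp := ⟨hy'b, by
        rw [mem_setOf_eq, hinner]; nlinarith [sq_pos_of_pos hwpos]⟩
      exact Set.disjoint_left.1 hVW (hPV hy'P) hy'W
  rcases hsideP with hP | hP <;> rcases hsideQ with hQ | hQ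
  · exact (key U₁ U₂ h₂ hdisj hz₂ hP hQ).elim
  · exact Or.inl ⟨hP hpH, hQ hqH⟩
  · exact Or.inr ⟨hP hpH, hQ hqH⟩
  · exact (key U₂ U₁ h₁ hdisj.symm hz₁ hP hQ).elim

/-! ### Lattice edges through a cut midpoint -/

/-- **A closed lattice edge through the midpoint of a lattice edge is that edge.** [folklore] -/
theorem sym2_eq_of_midpoint_mem_segment {δ : ℝ} (hδ : 0 < δ) {u v x y : Site 2}
    (huv : (zdGraph 2).Adj u v) (hxy : (zdGraph 2).Adj x y)
    (h : (2⁻¹ : ℝ) • (meshPoint δ u + meshPoint δ v) ∈ segment ℝ (meshPoint δ x) (meshPoint δ y)) :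
    s(x, y) = s(u, v) := by
  obtain ⟨i, hi, hl⟩ := Mesh.exists_coord_eq_of_adj huv
  have hmid : ∀ (k n : ℤ), (u 0 + v 0 : ℝ) = 2 * k + 1 → (u 1 : ℝ) = n → (v 1 : ℝ) = n →
      (2⁻¹ : ℝ) • (meshPoint δ u + meshPoint δ v) = (⟨δ * (k + 1 / 2), δ * n⟩ : ℂ) := by
    intro k n h0 h1 h2
    apply Complex.ext
    · simp only [Complex.real_smul, Complex.mul_re, Complex.ofReal_re, Complex.ofReal_im, Complex.add_re,
        meshPoint_re, zero_mul, sub_zero]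
      rw [← mul_add, ← Int.cast_add] at *
      push_cast at h0 ⊢; rw [show (u 0 : ℝ) + v 0 = 2 * k + 1 by exact_mod_cast h0]; ring
    · simp only [Complex.real_smul, Complex.mul_im, Complex.ofReal_re, Complex.ofReal_im, Complex.add_im,
        meshPoint_im, zero_mul, add_zero]
      rw [h1, h2]; ring
  have hmid' : ∀ (k n : ℤ), (u 1 + v 1 : ℝ) = 2 * n + 1 → (u 0 : ℝ) = k → (v 0 : ℝ) = k →
      (2⁻¹ : ℝ) • (meshPoint δ u + meshPoint δ v) = (⟨δ * k, δ * (n + 1 / 2)⟩ : ℂ) := by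
    intro k n h0 h1 h2
    apply Complex.ext
    · simp only [Complex.real_smul, Complex.mul_re, Complex.ofReal_re, Complex.ofReal_im, Complex.add_re,
        meshPoint_re, zero_mul, sub_zero]
      rw [h1, h2]; ring
    · simp only [Complex.real_smul, Complex.mul_im, Complex.ofReal_re, Complex.ofReal_im, Complex.add_im,
        meshPoint_im, zero_mul, add_zero]
      rw [← mul_add, show (u 1 : ℝ) + v 1 = 2 * n + 1 by exact_mod_cast h0]; ring
  fin_cases i
  · have h1 : v 1 = u 1 := hl 1 (by decide)
    rcases hi with hi | hi
    · have hi' : v 0 = u 0 + 1 := hi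
      rw [hmid (u 0) (u 1) (by push_cast [hi']; ring) rfl (by exact_mod_cast h1)] at h
      rw [sym2_eq_of_midpoint_mem_segment_h hδ hxy h]
      congr 1
      · exact site_ext (by simp) (by simp)
      · exact site_ext (by simpa using hi'.symm) (by simpa using h1.symm)
    · have hi' : u 0 = v 0 + 1 := hi
      rw [hmid (v 0) (u 1) (by push_cast [hi']; ring) rfl (by exact_mod_cast h1)] at h
      rw [sym2_eq_of_midpoint_mem_segment_h hδ hxy h, Sym2.eq_swap]
      congr 1
      · exact site_ext (by simpa using hi'.symm) (by simp)
      · exact site_ext (by simp) (by simpa using h1.symm)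
  · have h0 : v 0 = u 0 := hl 0 (by decide)
    rcases hi with hi | hi
    · have hi' : v 1 = u 1 + 1 := hi
      rw [hmid' (u 0) (u 1) (by push_cast [hi']; ring) rfl (by exact_mod_cast h0)] at h
      rw [sym2_eq_of_midpoint_mem_segment_v hδ hxy h]
      congr 1
      · exact site_ext (by simp) (by simp)
      · exact site_ext (by simpa using h0.symm) (by simpa using hi'.symm)
    · have hi' : u 1 = v 1 + 1 := hi
      rw [hmid' (u 0) (v 1) (by push_cast [hi']; ring) rfl (by exact_mod_cast h0)] at h
      rw [sym2_eq_of_midpoint_mem_segment_v hδ hxy h, Sym2.eq_swap]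
      congr 1
      · exact site_ext (by simp) (by simpa using hi'.symm)
      · exact site_ext (by simpa using h0.symm) (by simp)

/-! ### No forced site on one side -/

/-- Units: `e_{m+2+2} = e_m` and `e_m + e_{m+2} = 0`. [folklore] -/
theorem cornerUnit_add_two_add_two (m : Fin 4) : cornerUnit (m + 2 + 2) = cornerUnit m := by
  rw [add_assoc, show (2 : Fin 4) + 2 = 0 by decide, add_zero]

/-- **No forced site on one side.** See the module docstring. [folklore] -/
theorem not_closedBall_subset_side {Ω : Set ℂ} {δ : ℝ} (hΩ : IsOpen Ω) (hδ : 0 < δ)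
    (hfin : ((⟨Ω, δ, ∅, ∅⟩ : DiscreteDobrushin).zdBoundary).Finite)
    {χ U₁ U₂ : Set ℂ} (h₁ : IsOpen U₁) (h₂ : IsOpen U₂) (hdisj : Disjoint U₁ U₂) (hcover : Ω \ χ ⊆ U₁ ∪ U₂)
    {ua va ub vb : Site 2} {ma mb : Fin 4} (hva : va = ua + cornerUnit ma) (hvb : vb = ub + cornerUnit mb)
    (hbva : ∀ p ∈ χ, p ∈ Ω → ∀ α β : ℝ, 0 ≤ α → α ≤ 2 → -1 ≤ β → β ≤ 1 →
      p ≠ meshPoint δ va + α • meshPoint δ (cornerUnit ma) + β • meshPoint δ (cornerUnit (ma + 1)))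
    (hbua : ∀ p ∈ χ, p ∈ Ω → ∀ α β : ℝ, 0 ≤ α → α ≤ 2 → -1 ≤ β → β ≤ 1 →
      p ≠ meshPoint δ ua + α • meshPoint δ (cornerUnit (ma + 2)) + β • meshPoint δ (cornerUnit (ma + 2 + 1)))
    (hbvb : ∀ p ∈ χ, p ∈ Ω → ∀ α β : ℝ, 0 ≤ α → α ≤ 2 → -1 ≤ β → β ≤ 1 →
      p ≠ meshPoint δ vb + α • meshPoint δ (cornerUnit mb) + β • meshPoint δ (cornerUnit (mb + 1)))
    (hbub : ∀ p ∈ χ, p ∈ Ω → ∀ α β : ℝ, 0 ≤ α → α ≤ 2 → -1 ≤ β → β ≤ 1 →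
      p ≠ meshPoint δ ub + α • meshPoint δ (cornerUnit (mb + 2)) + β • meshPoint δ (cornerUnit (mb + 2 + 1)))
    (hnda : ¬ (δ + infDist (meshPoint δ va) (frontier Ω) ≤ infDist (meshPoint δ ua) (frontier Ω)) ∧
      ¬ (δ + infDist (meshPoint δ ua) (frontier Ω) ≤ infDist (meshPoint δ va) (frontier Ω)))
    (hndb : ¬ (δ + infDist (meshPoint δ vb) (frontier Ω) ≤ infDist (meshPoint δ ub) (frontier Ω)) ∧
      ¬ (δ + infDist (meshPoint δ ub) (frontier Ω) ≤ infDist (meshPoint δ vb) (frontier Ω)))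
    (hcut : ∀ x ∈ (⟨Ω, δ, ∅, ∅⟩ : DiscreteDobrushin).zdBoundary, ∀ y ∈ (⟨Ω, δ, ∅, ∅⟩ : DiscreteDobrushin).zdBoundary,
      (discreteDomainGraph Ω δ).Adj x y → meshPoint δ x ∈ U₁ → meshPoint δ y ∈ U₂ →
      s(x, y) = s(ua, va) ∨ s(x, y) = s(ub, vb))
    {y : Site 2} (hy : y ∈ (⟨Ω, δ, ∅, ∅⟩ : DiscreteDobrushin).zdBoundary) (hyU : meshPoint δ y ∈ U₁) :
    ¬ closedBall (meshPoint δ y) (infDist (meshPoint δ y) (frontier Ω)) ⊆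
      ⋃ x ∈ {x | x ∈ (⟨Ω, δ, ∅, ∅⟩ : DiscreteDobrushin).zdBoundary ∧ meshPoint δ x ∈ U₂},
        closedBall (meshPoint δ x) (infDist (meshPoint δ x) (frontier Ω)) := by
  set X : Set (Site 2) := {x | x ∈ (⟨Ω, δ, ∅, ∅⟩ : DiscreteDobrushin).zdBoundary ∧ meshPoint δ x ∈ U₂} with hX
  have hXB : X ⊆ (⟨Ω, δ, ∅, ∅⟩ : DiscreteDobrushin).zdBoundary := fun x hx => hx.1
  have hXfin : X.Finite := hfin.subset hXB
  have hyX : y ∉ X := fun h => Set.disjoint_left.1 hdisj hyU h.2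
  have hcover' : Ω \ χ ⊆ U₂ ∪ U₁ := by rw [union_comm]; exact hcover
  -- the far-pole argument at an end `v` of a cut edge, direction `m` away from the partner
  have key : ∀ (v : Site 2) (m : Fin 4), y = v →
      (∀ p ∈ χ, p ∈ Ω → ∀ α β : ℝ, 0 ≤ α → α ≤ 2 → -1 ≤ β → β ≤ 1 →
        p ≠ meshPoint δ v + α • meshPoint δ (cornerUnit m) + β • meshPoint δ (cornerUnit (m + 1))) →
      ¬ (δ + infDist (meshPoint δ v) (frontier Ω) ≤ infDist (meshPoint δ (v + cornerUnit (m + 2))) (frontier Ω)) →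
      ¬ closedBall (meshPoint δ y) (infDist (meshPoint δ y) (frontier Ω)) ⊆
        ⋃ x ∈ X, closedBall (meshPoint δ x) (infDist (meshPoint δ x) (frontier Ω)) := by
    rintro v m rfl hbox hnd
    refine not_closedBall_subset_of_farPole (E := ⟨Ω, δ, ∅, ∅⟩) hΩ hδ hy hXB m ?_ hnd
    intro x' hx' _ a b h0a ha2 hb1 hb2 hxe s hs hsρ hq
    exact farPole_side (E := ⟨Ω, δ, ∅, ∅⟩) hΩ hδ h₂ h₁ hdisj.symm hcover' hy hyU m hbox hx'.1 hx'.2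
      h0a ha2 hb1 hb2 hxe hs hsρ hq
  by_cases hadj : ∃ x ∈ X, (discreteDomainGraph Ω δ).Adj y x
  · obtain ⟨x, hx, hyx⟩ := hadj
    have hua : va + cornerUnit (ma + 2) = ua := by rw [hva, add_assoc, cornerUnit_add_two, add_neg_cancel, add_zero]
    have hva' : ua + cornerUnit (ma + 2 + 2) = va := by rw [cornerUnit_add_two_add_two, hva]
    have hub : vb + cornerUnit (mb + 2) = ub := by rw [hvb, add_assoc, cornerUnit_add_two, add_neg_cancel, add_zero]
    have hvb' : ub + cornerUnit (mb + 2 + 2) = vb := by rw [cornerUnit_add_two_add_two, hvb]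
    rcases hcut y hy x hx.1 hyx hyU hx.2 with h | h
    · rcases Sym2.eq_iff.1 h with ⟨hyv, -⟩ | ⟨hyv, -⟩
      · exact key ua (ma + 2) hyv hbua (by rw [hva']; exact hnda.2)
      · exact key va ma hyv hbva (by rw [hua]; exact hnda.1)
    · rcases Sym2.eq_iff.1 h with ⟨hyv, -⟩ | ⟨hyv, -⟩
      · exact key ub (mb + 2) hyv hbub (by rw [hvb']; exact hndb.2)
      · exact key vb mb hyv hbvb (by rw [hub]; exact hndb.1)
  · push Not at hadj
    exact not_closedBall_subset_of_forall_not_adj (E := ⟨Ω, δ, ∅, ∅⟩) hΩ hδ hy hXB hXfin hyX hadj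

/-! ### Distance to the arc on one side -/

/-- **A boundary site on one side is close to the corresponding arc.** See the module docstring.
[folklore] -/
theorem infDist_arc_le_side {Ω : Set ℂ} {δ : ℝ} (hΩ : IsOpen Ω) (hδ : 0 < δ)
    {χ U₁ U₂ : Set ℂ} (h₁ : IsOpen U₁) (h₂ : IsOpen U₂) (hdisj : Disjoint U₁ U₂) (hχ : IsClosed χ)
    (hD : Ω ⊆ U₁ ∪ U₂ ∪ χ) (hfr : frontier U₁ ∩ frontier U₂ ⊆ χ) (hU₁Ω : U₁ ⊆ Ω)
    {ARC : Set ℂ} {a b ca cb : ℂ} {η η₁ : ℝ} (hη : 0 ≤ η) (ha : a ∈ ARC) (hb : b ∈ ARC)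
    (hca : dist ca a < η₁) (hcb : dist cb b < η₁)
    (hχfr : ∀ z ∈ χ, z ∉ Ω → z = ca ∨ z = cb)
    (hfrU : ∀ f ∈ frontier U₁, f ∉ Ω → f ∉ χ → infDist f ARC ≤ η)
    (hχnear : ∀ z ∈ χ, dist z a < η₁ ∨ dist z b < η₁ ∨ 20 * δ < infDist z (frontier Ω))
    {y : Site 2} (hy : y ∈ (⟨Ω, δ, ∅, ∅⟩ : DiscreteDobrushin).zdBoundary) (hyU : meshPoint δ y ∈ U₁) :
    infDist (meshPoint δ y) ARC ≤ η + η₁ + 2 * δ := by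
  set P := meshPoint δ y with hP
  set r := infDist P (frontier Ω) with hr
  have hr0 : 0 < r := infDist_frontier_pos (E := ⟨Ω, δ, ∅, ∅⟩) hΩ hδ hy
  have hr2 : r < 2 * δ := by
    have h1 := infDist_frontier_le_sqrt_two (E := ⟨Ω, δ, ∅, ∅⟩) hΩ hδ hy
    have hs : Real.sqrt 2 < 2 := by rw [Real.sqrt_lt' (by norm_num)]; norm_num
    exact lt_of_le_of_lt h1 (by nlinarith)
  have hPΩ : P ∈ Ω := meshDomain_subset_meshVertices _ _
    (DiscreteDobrushin.zdBoundary_subset_meshDomain (⟨Ω, δ, ∅, ∅⟩ : DiscreteDobrushin) hy)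
  have hfrne : (frontier Ω).Nonempty := by
    by_contra h; rw [not_nonempty_iff_eq_empty] at h
    have : r = 0 := by rw [hr, h, infDist_empty]
    linarith
  obtain ⟨f, hf, hfd⟩ := isClosed_frontier.exists_infDist_eq_dist hfrne P
  have hfΩ : f ∉ Ω := fun h => by
    have := hΩ.interior_eq ▸ (hf.2 : f ∉ interior Ω); exact this h
  -- distance bookkeeping
  have hnear_pt : ∀ c : ℂ, c ∈ ARC → ∀ ρ : ℝ, dist P c ≤ ρ → infDist P ARC ≤ ρ := fun c hc ρ h =>
    (infDist_le_dist_of_mem hc).trans h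
  by_cases hmeet : ∃ z ∈ χ, dist z P < r
  · obtain ⟨z, hzχ, hzr⟩ := hmeet
    rcases hχnear z hzχ with h | h | h
    · exact hnear_pt a ha _ (by linarith [dist_triangle P z a, dist_comm z P])
    · exact hnear_pt b hb _ (by linarith [dist_triangle P z b, dist_comm z P])
    · exfalso
      have := infDist_le_infDist_add_dist (s := frontier Ω) (x := z) (y := P)
      linarith
  · push Not at hmeet
    have hballχ : Disjoint (ball P r) χ := Set.disjoint_left.2 fun z hz hzχ => by
      have := hmeet z hzχ; rw [mem_ball] at hz; linarith
    have hball : ball P r ⊆ Ω := ball_infDist_frontier_subset' hΩ hPΩ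
    have hballU : ball P r ⊆ U₁ := (ball_subset_of_mem h₁ h₂ hdisj hχ hD hfr hball hballχ).1 hyU
    have hfU : f ∈ frontier U₁ :=
      mem_frontier_of_mem_closedBall hU₁Ω hr0 hballU (mem_closedBall.2 (by rw [dist_comm]; exact hfd.symm.le)) hfΩ
    by_cases hfχ : f ∈ χ
    · have h3 : dist P f = r := hfd.symm
      rcases hχfr f hfχ hfΩ with hfc | hfc
      · refine hnear_pt a ha _ ?_
        have := dist_triangle P f a; rw [hfc] at this h3; linarith
      · refine hnear_pt b hb _ ?_
        have := dist_triangle P f b; rw [hfc] at this h3; linarith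
    · have := hfrU f hfU hfΩ hfχ
      have h2 := infDist_le_infDist_add_dist (s := ARC) (x := P) (y := f)
      have h3 : dist P f = r := hfd.symm
      have hη₁ : 0 < η₁ := lt_of_le_of_lt dist_nonneg hca
      linarith

end Summit.CriticalPhenomena.CardyFormulaZ2.Theorems.DiscretisationFamilyExists

end
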